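import Summits.NavierStokesRegularity.FluidComputer.RotorKnob
import HarnessLib

/-!
# The seed–rotor scale knob, part 2 of 6: before the critical time

Part 2 of `RotorKnob*.lean` (cell `pub-fluidc`, blueprint seat bp1, gen 22; namespace
`Summit.NavierStokesRegularity.FluidComputer.RotorKnob`; see part 1 `RotorKnob.lean` for the family
`rotorCircuit K M ε ρ`, the headline `rotorScaleTransition` and the substitution table).
HONEST FRAMING: low prior, high value-of-information experiment on Tao's machine paradigm; NOT a
claim that NS blows up.
Five-mode ODE analysis of [Tao2016AveragedNS, §5.5] with the clock/amplifier scale `ε` and the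
seed/rotor scale `ρ` kept apart; nothing is proved about Navier–Stokes.

THIS FILE: (code) `c_crude` — `c ≤ 2ρ²e^{(5t-1)M}` on `[0,2]`; (dora) `de_small` — while
`c ≤ K⁻¹⁰ρ²`: `|d|, |ã| ≤ 3K⁻¹⁰` (the rotor `ρ⁻²` against the level `K⁻¹⁰ρ²`: `ρ` cancels); (able2)
`a_near_one` — `|a - 1| ≤ 8K⁻²⁰` (the seed term is `ρ⁴K⁻¹⁰ ≤ ε²`); (bogo-2) `b_linear` —
`|b - εt| ≤ 17εtK⁻²⁰` (uses `Mρ⁴ ≤ ε²`); and the sharp super-solution `c_upper_sharp` —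
`c ≤ 2ρ²e^{Mt²/2 + 1 - M}` on `[0, τ]`.
[cite: Tao2016AveragedNS, §5.5 (code), (dora), (able2), (bogo-2), (tcable)]. No named facts;
0 sorry.
-/

noncomputable section

namespace Summit.NavierStokesRegularity.FluidComputer.RotorKnob

open Set Real Filter
open _root_.Topology
open Literature.Analysis.FluidPDE.Tao2016AveragedNS
open Literature.Analysis.FluidPDE.Tao2016AveragedNS.Thm53 (antitoneOn_intFactor monotoneOn_intFactor
  antitoneOn_sub_of_deriv_le monotoneOn_sub_of_le_deriv exists_hitTime abs_sub_le_of_abs_deriv_le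
  sqrt_two_gt sqrt_two_lt invSqrt_facts Es_alg decay_alg numeric_N4 init_a init_b init_c init_d
  init_e)

variable {K M ε ρ τ δ : ℝ} {X : ℝ → Fin 5 → ℝ}

/-- (code): the crude Grönwall bound `c(t) ≤ 2ρ² e^{(5t-1)M}` on `[0,2]` (from
`∂ₜc ≤ μ + 5K¹⁰ c`). [cite: Tao2016AveragedNS, §5.5 (code)] -/
theorem c_crude (hX : ∀ t, HasDerivAt X (rotorCircuit K M ε ρ (X t)) t) (h0 : X 0 = delayInit)
    (hε : 0 < ε) (hρ : 0 < ρ) (hρε : ρ ^ 2 ≤ ε) (hM0 : 0 ≤ M) {t : ℝ} (ht : t ∈ Icc 0 2) :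
    X t 2 ≤ 2 * ρ ^ 2 * exp ((5 * t - 1) * M) := by
  set μ := ρ ^ 2 * exp (-M) with hμ
  have hμ0 : 0 ≤ μ := by positivity
  have hanti := antitoneOn_intFactor (s := Icc 0 2) (g := fun _ => 5 * M)
    (G := fun s => 5 * M * s) (φ := fun _ => μ) (Φ := fun s => μ * s) (convex_Icc 0 2)
    (fun s _ => hasDerivAt_c hX s)
    (fun s _ => ((hasDerivAt_id s).const_mul (5 * M)).congr_deriv (by simp))
    (fun s _ => ((hasDerivAt_id s).const_mul μ).congr_deriv (by simp))
    (fun s hs => by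
      have hc0 : 0 ≤ X s 2 := c_nonneg hX h0 hs.1
      have hb : |X s 1| ≤ 5 * ε := (bc_small hX h0 hε hρ hρε hM0 hs).1
      have ha : X s 0 ^ 2 ≤ 1 := traj_sq_le_one hX h0 s 0
      have hexp : exp (-(5 * M * s)) ≤ 1 := by
        rw [exp_le_one_iff, neg_nonpos]; have := hs.1; positivity
      have hk : 0 ≤ M := hM0
      have h1 : ρ ^ 2 * exp (-M) * X s 0 ^ 2 ≤ μ := by
        simpa [hμ] using mul_le_mul_of_nonneg_left ha (by positivity : 0 ≤ ρ ^ 2 * exp (-M))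
      have h2 : ε⁻¹ * M * X s 1 * X s 2 ≤ 5 * M * X s 2 := by
        have hb' : X s 1 ≤ 5 * ε := (le_abs_self _).trans hb
        have h5 : ε⁻¹ * X s 1 ≤ 5 := by
          rw [inv_mul_le_iff₀ hε]; linarith
        have : ε⁻¹ * M * X s 1 * X s 2 = (ε⁻¹ * X s 1) * (M * X s 2) := by ring
        rw [this]
        nlinarith [mul_nonneg hk hc0]
      have hbr : ρ ^ 2 * exp (-M) * X s 0 ^ 2 + ε⁻¹ * M * X s 1 * X s 2
          - 5 * M * X s 2 ≤ μ := by linarith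
      calc (ρ ^ 2 * exp (-M) * X s 0 ^ 2 + ε⁻¹ * M * X s 1 * X s 2
            - 5 * M * X s 2) * exp (-(5 * M * s))
          ≤ μ * exp (-(5 * M * s)) := mul_le_mul_of_nonneg_right hbr (exp_pos _).le
        _ ≤ μ * 1 := mul_le_mul_of_nonneg_left hexp hμ0
        _ = μ := mul_one _)
  have h0mem : (0 : ℝ) ∈ Icc (0 : ℝ) 2 := ⟨le_rfl, by norm_num⟩
  have h := hanti h0mem ht ht.1
  simp only [init_c h0, zero_mul, mul_zero, sub_zero] at h
  -- `c t * exp(-5kt) - μ t ≤ 0`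
  have h' : X t 2 * exp (-(5 * M * t)) ≤ μ * t := by linarith
  have hexp : X t 2 = X t 2 * exp (-(5 * M * t)) * exp (5 * M * t) := by
    rw [mul_assoc, ← exp_add, neg_add_cancel, exp_zero, mul_one]
  rw [hexp]
  calc X t 2 * exp (-(5 * M * t)) * exp (5 * M * t)
      ≤ μ * t * exp (5 * M * t) := mul_le_mul_of_nonneg_right h' (exp_pos _).le
    _ ≤ μ * 2 * exp (5 * M * t) := by
        have := ht.2
        exact mul_le_mul_of_nonneg_right (mul_le_mul_of_nonneg_left this hμ0) (exp_pos _).le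
    _ = 2 * ρ ^ 2 * exp ((5 * t - 1) * M) := by
        simp only [hμ]
        rw [show (5 * t - 1) * M = -M + 5 * M * t by ring, exp_add]
        ring




/-! ## Up to the critical time: (dora), (able2), (bogo-2) and the sharp comparison for `c`

Throughout, `τ` is a time with `c ≤ K⁻¹⁰ρ²` on `[0,τ]` ((boots); it will be the hitting time). -/


/-- (dora): `|d|, |ã| ≤ 3K⁻¹⁰` on `[0,τ]`, from `∂ₜ(d²+ã²) = 2ρ⁻²c·a·d` applied to
`√(d²+ã²+K⁻²⁰)`. [cite: Tao2016AveragedNS, §5.5 (dora)] -/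
theorem de_small (hX : ∀ t, HasDerivAt X (rotorCircuit K M ε ρ (X t)) t) (h0 : X 0 = delayInit)
    (hρ : 0 < ρ) (hK : 0 < K) (hτ2 : τ ≤ 2)
    (hcτ : ∀ t, 0 ≤ t → t ≤ τ → X t 2 ≤ ρ ^ 2 / K ^ 10)
    {t : ℝ} (ht : t ∈ Icc 0 τ) : |X t 3| ≤ 3 / K ^ 10 ∧ |X t 4| ≤ 3 / K ^ 10 := by
  set κ : ℝ := (K ^ 10)⁻¹ with hκ
  have hκ0 : 0 < κ := by positivity
  set u : ℝ → ℝ := fun s => X s 3 ^ 2 + X s 4 ^ 2 with hu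
  set h : ℝ → ℝ := fun s => sqrt (u s + κ ^ 2) with hh
  have hupos : ∀ s, 0 < u s + κ ^ 2 := fun s => by positivity
  have hd_le : ∀ s, |X s 3| ≤ h s := fun s =>
    abs_le_sqrt (by simp only [hu]; nlinarith [sq_nonneg (X s 4)])
  have he_le : ∀ s, |X s 4| ≤ h s := fun s =>
    abs_le_sqrt (by simp only [hu]; nlinarith [sq_nonneg (X s 3)])
  have hder : ∀ s, HasDerivAt h
      ((2 * (ρ ^ 2)⁻¹ * X s 2 * X s 0 * X s 3) / (2 * sqrt (u s + κ ^ 2))) s := fun s =>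
    ((rotorCircuit_out_energy (hX s)).add_const (κ ^ 2)).sqrt (hupos s).ne'
  have hbound : ∀ s ∈ Icc 0 τ,
      (2 * (ρ ^ 2)⁻¹ * X s 2 * X s 0 * X s 3) / (2 * sqrt (u s + κ ^ 2)) ≤ κ := by
    intro s hs
    have hhpos : 0 < sqrt (u s + κ ^ 2) := sqrt_pos.2 (hupos s)
    rw [div_le_iff₀ (by positivity)]
    have hc0 : 0 ≤ X s 2 := c_nonneg hX h0 hs.1
    have hcθ : X s 2 ≤ ρ ^ 2 / K ^ 10 := hcτ s hs.1 hs.2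
    have ha : |X s 0| ≤ 1 := traj_abs_le_one hX h0 s 0
    have hds : |X s 3| ≤ h s := hd_le s
    have hh' : h s = sqrt (u s + κ ^ 2) := rfl
    rw [← hh']
    have h1 : |X s 0 * X s 3| ≤ h s := by
      rw [abs_mul]
      calc |X s 0| * |X s 3| ≤ 1 * h s := mul_le_mul ha hds (abs_nonneg _) zero_le_one
        _ = h s := one_mul _
    have h2 : (ρ ^ 2)⁻¹ * X s 2 ≤ κ := by
      calc (ρ ^ 2)⁻¹ * X s 2 ≤ (ρ ^ 2)⁻¹ * (ρ ^ 2 / K ^ 10) :=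
            mul_le_mul_of_nonneg_left hcθ (by positivity)
        _ = κ := by simp only [hκ]; field_simp
    have h3 : 0 ≤ (ρ ^ 2)⁻¹ * X s 2 := by positivity
    have h4 : (ρ ^ 2)⁻¹ * X s 2 * (X s 0 * X s 3) ≤ κ * h s :=
      calc (ρ ^ 2)⁻¹ * X s 2 * (X s 0 * X s 3) ≤ (ρ ^ 2)⁻¹ * X s 2 * |X s 0 * X s 3| :=
            mul_le_mul_of_nonneg_left (le_abs_self _) h3
        _ ≤ κ * h s := mul_le_mul h2 h1 (abs_nonneg _) hκ0.le
    have : 2 * (ρ ^ 2)⁻¹ * X s 2 * X s 0 * X s 3 = 2 * ((ρ ^ 2)⁻¹ * X s 2 * (X s 0 * X s 3)) := by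
      ring
    rw [this]
    linarith
  have hanti := antitoneOn_sub_of_deriv_le (Φ := fun s => κ * s) (convex_Icc 0 τ)
    (fun s _ => hder s) (fun s _ => ((hasDerivAt_id s).const_mul κ).congr_deriv (by simp)) hbound
  have h0mem : (0 : ℝ) ∈ Icc (0 : ℝ) τ := ⟨le_rfl, ht.1.trans ht.2⟩
  have hmono := hanti h0mem ht ht.1
  have hh0 : h 0 = κ := by
    simp only [hh, hu, init_d h0, init_e h0]
    simpa using sqrt_sq hκ0.le
  simp only [hh0, mul_zero, sub_zero] at hmono
  have hht : h t ≤ 3 / K ^ 10 := by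
    have ht2 : t ≤ 2 := ht.2.trans hτ2
    have : h t ≤ κ + κ * t := by linarith
    calc h t ≤ κ + κ * t := this
      _ ≤ κ + κ * 2 := by nlinarith
      _ = 3 / K ^ 10 := by simp only [hκ]; ring
  exact ⟨(hd_le t).trans hht, (he_le t).trans hht⟩

/-- (able2) for `a`: `|a - 1| ≤ 8K⁻²⁰` on `[0,τ]` (from `∂ₜa = O(K⁻²⁰) + O(ε²)`; the seed term is
`O(ρ⁴K⁻¹⁰) = O(ε²)` because `c ≤ ρ²K⁻¹⁰` before the critical time).
[cite: Tao2016AveragedNS, §5.5 (able2)] -/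
theorem a_near_one (hX : ∀ t, HasDerivAt X (rotorCircuit K M ε ρ (X t)) t) (h0 : X 0 = delayInit)
    (hε : 0 < ε) (hρ : 0 < ρ) (hρε : ρ ^ 2 ≤ ε) (hM0 : 0 ≤ M) (hK : 1 ≤ K) (hτ2 : τ ≤ 2)
    (hεK : ε ^ 2 ≤ 1 / (6 * K ^ 20))
    (hcτ : ∀ t, 0 ≤ t → t ≤ τ → X t 2 ≤ ρ ^ 2 / K ^ 10)
    {t : ℝ} (ht : t ∈ Icc 0 τ) : |X t 0 - 1| ≤ 8 / K ^ 20 := by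
  have hK0 : 0 < K := by linarith
  have hM : ∀ s ∈ Icc 0 τ, |(-((ρ ^ 2)⁻¹ * X s 2 * X s 3) - ε * X s 0 * X s 1
      - ρ ^ 2 * exp (-M) * X s 0 * X s 2)| ≤ 4 / K ^ 20 := by
    intro s hs
    have hs2 : s ∈ Icc (0 : ℝ) 2 := ⟨hs.1, hs.2.trans hτ2⟩
    have hc0 : 0 ≤ X s 2 := c_nonneg hX h0 hs.1
    have hcθ : X s 2 ≤ ρ ^ 2 / K ^ 10 := hcτ s hs.1 hs.2
    have hd : |X s 3| ≤ 3 / K ^ 10 := (de_small hX h0 hρ hK0 hτ2 hcτ hs).1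
    have ha : |X s 0| ≤ 1 := traj_abs_le_one hX h0 s 0
    have hb : |X s 1| ≤ 5 * ε := (bc_small hX h0 hε hρ hρε hM0 hs2).1
    have hc1 : |X s 2| ≤ 1 := traj_abs_le_one hX h0 s 2
    have hek : exp (-M) ≤ 1 := by rw [exp_le_one_iff, neg_nonpos]; exact hM0
    -- term 1: `|ρ c d| ≤ 3 K⁻²⁰`
    have h1 : |(ρ ^ 2)⁻¹ * X s 2 * X s 3| ≤ 3 / K ^ 20 := by
      rw [abs_mul, abs_of_nonneg (by positivity : 0 ≤ (ρ ^ 2)⁻¹ * X s 2)]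
      calc (ρ ^ 2)⁻¹ * X s 2 * |X s 3| ≤ (ρ ^ 2)⁻¹ * (ρ ^ 2 / K ^ 10) * (3 / K ^ 10) :=
            mul_le_mul (mul_le_mul_of_nonneg_left hcθ (by positivity)) hd (abs_nonneg _)
              (by positivity)
        _ = 3 / K ^ 20 := by field_simp
    -- term 2: `|ε a b| ≤ 5ε²`
    have h2 : |ε * X s 0 * X s 1| ≤ 5 * ε ^ 2 := by
      rw [abs_mul, abs_mul, abs_of_pos hε]
      calc ε * |X s 0| * |X s 1| ≤ ε * 1 * (5 * ε) :=
            mul_le_mul (mul_le_mul_of_nonneg_left ha hε.le) hb (abs_nonneg _) (by positivity)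
        _ = 5 * ε ^ 2 := by ring
    -- term 3: `|μ a c| ≤ ρ² · ρ²K⁻¹⁰ ≤ ρ⁴ ≤ ε²` (the seed is `ρ²e^{-M} ≤ ρ²`, and `c ≤ ρ²K⁻¹⁰` on
    -- `[0,τ]`)
    have h3 : |ρ ^ 2 * exp (-M) * X s 0 * X s 2| ≤ ε ^ 2 := by
      rw [abs_mul, abs_mul, abs_mul, abs_of_pos (pow_pos hρ 2), abs_of_pos (exp_pos _),
        abs_of_nonneg hc0]
      have hK10 : (1 : ℝ) ≤ K ^ 10 := one_le_pow₀ hK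
      have hcρ : X s 2 ≤ ρ ^ 2 := hcθ.trans (div_le_self (sq_nonneg _) hK10)
      have hρ4 : ρ ^ 2 * ρ ^ 2 ≤ ε * ε :=
        mul_le_mul hρε hρε (sq_nonneg _) hε.le
      calc ρ ^ 2 * exp (-M) * |X s 0| * X s 2 ≤ ρ ^ 2 * 1 * 1 * ρ ^ 2 :=
            mul_le_mul (mul_le_mul (mul_le_mul_of_nonneg_left hek (by positivity)) ha
              (abs_nonneg _) (by positivity)) hcρ hc0 (by positivity)
        _ = ρ ^ 2 * ρ ^ 2 := by ring
        _ ≤ ε ^ 2 := by rw [sq ε]; exact hρ4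
    have h6 : 6 * ε ^ 2 ≤ 1 / K ^ 20 := by
      have := hεK
      rw [le_div_iff₀ (by positivity)] at this
      rw [le_div_iff₀ (by positivity)]
      linarith
    calc |(-((ρ ^ 2)⁻¹ * X s 2 * X s 3) - ε * X s 0 * X s 1 - ρ ^ 2 * exp (-M) * X s 0 * X s 2)|
        ≤ |(-((ρ ^ 2)⁻¹ * X s 2 * X s 3) - ε * X s 0 * X s 1)|
          + |ρ ^ 2 * exp (-M) * X s 0 * X s 2| := abs_sub _ _
      _ ≤ |(-((ρ ^ 2)⁻¹ * X s 2 * X s 3))| + |ε * X s 0 * X s 1|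
          + |ρ ^ 2 * exp (-M) * X s 0 * X s 2| := by
          have := abs_sub (-((ρ ^ 2)⁻¹ * X s 2 * X s 3)) (ε * X s 0 * X s 1)
          linarith
      _ ≤ 3 / K ^ 20 + 5 * ε ^ 2 + ε ^ 2 := by rw [abs_neg]; linarith
      _ ≤ 4 / K ^ 20 := by
          have : 3 / K ^ 20 + 6 * ε ^ 2 ≤ 3 / K ^ 20 + 1 / K ^ 20 := by linarith
          calc 3 / K ^ 20 + 5 * ε ^ 2 + ε ^ 2 = 3 / K ^ 20 + 6 * ε ^ 2 := by ring
            _ ≤ 3 / K ^ 20 + 1 / K ^ 20 := this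
            _ = 4 / K ^ 20 := by ring
  have := abs_sub_le_of_abs_deriv_le (fun s _ => hasDerivAt_a hX s) hM ht
  rw [init_a h0, sub_zero] at this
  calc |X t 0 - 1| ≤ 4 / K ^ 20 * t := this
    _ ≤ 4 / K ^ 20 * 2 := by
        have : t ≤ 2 := ht.2.trans hτ2
        exact mul_le_mul_of_nonneg_left this (by positivity)
    _ = 8 / K ^ 20 := by ring

/-- (bogo-2): `|b - εt| ≤ 17εt·K⁻²⁰` on `[0,τ]` (from `∂ₜb = ε + O(K⁻²⁰ε) + O(ε⁻¹Mρ⁴K⁻²⁰)`,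
`Mρ⁴ ≤ ε²`).
[cite: Tao2016AveragedNS, §5.5 (bogo-2)] -/
theorem b_linear (hX : ∀ t, HasDerivAt X (rotorCircuit K M ε ρ (X t)) t) (h0 : X 0 = delayInit)
    (hε : 0 < ε) (hρ : 0 < ρ) (hρε : ρ ^ 2 ≤ ε) (hM0 : 0 < M) (hK : 1 ≤ K) (hτ2 : τ ≤ 2)
    (hεK : ε ^ 2 ≤ 1 / (6 * K ^ 20)) (hMρ : M * ρ ^ 4 ≤ ε ^ 2)
    (hcτ : ∀ t, 0 ≤ t → t ≤ τ → X t 2 ≤ ρ ^ 2 / K ^ 10)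
    {t : ℝ} (ht : t ∈ Icc 0 τ) : |X t 1 - ε * t| ≤ 17 * ε / K ^ 20 * t := by
  have hK0 : 0 < K := by linarith
  have hM : ∀ s ∈ Icc 0 τ,
      |ε * X s 0 ^ 2 - ε⁻¹ * M * X s 2 ^ 2 - ε * 1| ≤ 17 * ε / K ^ 20 := by
    intro s hs
    have hc0 : 0 ≤ X s 2 := c_nonneg hX h0 hs.1
    have hcθ : X s 2 ≤ ρ ^ 2 / K ^ 10 := hcτ s hs.1 hs.2
    have ha1 : |X s 0 - 1| ≤ 8 / K ^ 20 := a_near_one hX h0 hε hρ hρε hM0.le hK hτ2 hεK hcτ hs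
    have ha : |X s 0| ≤ 1 := traj_abs_le_one hX h0 s 0
    -- `|ε (a² - 1)| ≤ 16 ε K⁻²⁰`
    have h1 : |ε * (X s 0 ^ 2 - 1)| ≤ 16 * ε / K ^ 20 := by
      rw [abs_mul, abs_of_pos hε, show X s 0 ^ 2 - 1 = (X s 0 - 1) * (X s 0 + 1) by ring, abs_mul]
      have hp1 : |X s 0 + 1| ≤ 2 := by
        calc |X s 0 + 1| ≤ |X s 0| + |1| := abs_add_le _ _
          _ ≤ 1 + 1 := by rw [abs_one]; linarith
          _ = 2 := by norm_num
      calc ε * (|X s 0 - 1| * |X s 0 + 1|) ≤ ε * (8 / K ^ 20 * 2) :=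
            mul_le_mul_of_nonneg_left (mul_le_mul ha1 hp1 (abs_nonneg _) (by positivity)) hε.le
        _ = 16 * ε / K ^ 20 := by ring
    -- `0 ≤ ν c² ≤ ε⁻¹ M ρ⁴ K⁻²⁰ ≤ ε K⁻²⁰` (`M ρ⁴ ≤ ε²`)
    have h2 : 0 ≤ ε⁻¹ * M * X s 2 ^ 2 := by
      have := hM0.le
      positivity
    have h3 : ε⁻¹ * M * X s 2 ^ 2 ≤ ε / K ^ 20 := by
      have hc2 : X s 2 ^ 2 ≤ (ρ ^ 2 / K ^ 10) ^ 2 := pow_le_pow_left₀ hc0 hcθ 2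
      calc ε⁻¹ * M * X s 2 ^ 2 ≤ ε⁻¹ * M * (ρ ^ 2 / K ^ 10) ^ 2 :=
            mul_le_mul_of_nonneg_left hc2 (by have := hM0.le; positivity)
        _ = ε⁻¹ * (M * ρ ^ 4) / K ^ 20 := by ring
        _ ≤ ε⁻¹ * ε ^ 2 / K ^ 20 :=
            div_le_div_of_nonneg_right (mul_le_mul_of_nonneg_left hMρ (by positivity))
                (by positivity)
        _ = ε / K ^ 20 := by rw [sq, ← mul_assoc, inv_mul_cancel₀ hε.ne', one_mul]
    rw [show ε * X s 0 ^ 2 - ε⁻¹ * M * X s 2 ^ 2 - ε * 1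
        = ε * (X s 0 ^ 2 - 1) - ε⁻¹ * M * X s 2 ^ 2 by ring]
    calc |ε * (X s 0 ^ 2 - 1) - ε⁻¹ * M * X s 2 ^ 2|
        ≤ |ε * (X s 0 ^ 2 - 1)| + |ε⁻¹ * M * X s 2 ^ 2| := abs_sub _ _
      _ ≤ 16 * ε / K ^ 20 + ε / K ^ 20 := by rw [abs_of_nonneg h2]; linarith
      _ = 17 * ε / K ^ 20 := by ring
  have hder : ∀ s ∈ Icc 0 τ, HasDerivAt (fun r => X r 1 - ε * r)
      (ε * X s 0 ^ 2 - ε⁻¹ * M * X s 2 ^ 2 - ε * 1) s := fun s _ =>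
    (hasDerivAt_b hX s).sub ((hasDerivAt_id s).const_mul ε)
  have := abs_sub_le_of_abs_deriv_le hder hM ht
  simpa [init_b h0] using this

/-- Sharp super-solution for `c` on `[0,τ]`: `c(t) ≤ 2ρ² exp(Mt²/2 + 1 - M)` (integrating
factor `exp(-(Mt²/2 + βt))`, `β = 34M K⁻²⁰ ≤ 34K⁻¹⁰`).
[cite: Tao2016AveragedNS, §5.5 proof of (tcable)] -/
theorem c_upper_sharp (hX : ∀ t, HasDerivAt X (rotorCircuit K M ε ρ (X t)) t) (h0 : X 0 = delayInit)
    (hε : 0 < ε) (hρ : 0 < ρ) (hρε : ρ ^ 2 ≤ ε) (hM0 : 0 < M) (hMK : M ≤ K ^ 10) (hK : 2 ≤ K)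
    (hτ2 : τ ≤ 2)
    (hεK : ε ^ 2 ≤ 1 / (6 * K ^ 20)) (hMρ : M * ρ ^ 4 ≤ ε ^ 2)
    (hcτ : ∀ t, 0 ≤ t → t ≤ τ → X t 2 ≤ ρ ^ 2 / K ^ 10)
    {t : ℝ} (ht : t ∈ Icc 0 τ) :
    X t 2 ≤ 2 * ρ ^ 2 * exp (M * t ^ 2 / 2 + 1 - M) := by
  have hK0 : 0 < K := by linarith
  have hK1 : 1 ≤ K := by linarith
  have hK68 : 68 ≤ K ^ 10 := by
    have : (2 : ℝ) ^ 10 ≤ K ^ 10 := pow_le_pow_left₀ (by norm_num) hK 10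
    nlinarith
  set β : ℝ := 34 * M / K ^ 20 with hβ
  have hβ0 : 0 ≤ β := by positivity
  have hβ1 : β ≤ 1 / 2 := by
    simp only [hβ]; rw [div_le_div_iff₀ (by positivity) (by norm_num)]
    have : K ^ 20 = K ^ 10 * K ^ 10 := by ring
    nlinarith [pow_pos hK0 10]
  set k : ℝ := M with hk
  have hk0 : 0 < k := hM0
  set μ : ℝ := ρ ^ 2 * exp (-k) with hμ
  have hμ0 : 0 ≤ μ := by positivity
  -- integrating factor `G(s) = k s²/2 + β s`
  have hG : ∀ s, HasDerivAt (fun r : ℝ => k / 2 * (r * r) + β * r) (k * s + β) s := by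
    intro s
    have := (((hasDerivAt_id s).mul (hasDerivAt_id s)).const_mul (k / 2)).add
      ((hasDerivAt_id s).const_mul β)
    exact this.congr_deriv (by simp; ring)
  have hanti := antitoneOn_intFactor (s := Icc 0 τ) (g := fun s => k * s + β)
    (G := fun r => k / 2 * (r * r) + β * r) (φ := fun _ => μ) (Φ := fun s => μ * s)
    (convex_Icc 0 τ) (fun s _ => hasDerivAt_c hX s) (fun s _ => hG s)
    (fun s _ => ((hasDerivAt_id s).const_mul μ).congr_deriv (by simp))
    (fun s hs => by
      have hc0 : 0 ≤ X s 2 := c_nonneg hX h0 hs.1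
      have ha : X s 0 ^ 2 ≤ 1 := traj_sq_le_one hX h0 s 0
      have hb : |X s 1 - ε * s| ≤ 17 * ε / K ^ 20 * s :=
        b_linear hX h0 hε hρ hρε hM0 hK1 hτ2 hεK hMρ hcτ hs
      have hs2 : s ≤ 2 := hs.2.trans hτ2
      -- `ν b ≤ k s + β`
      have hνb : ε⁻¹ * M * X s 1 ≤ k * s + β := by
        have hb' : X s 1 ≤ ε * s + 17 * ε / K ^ 20 * s := by
          have := (abs_le.1 hb).2; linarith
        have h34 : 17 * ε / K ^ 20 * s ≤ 34 * ε / K ^ 20 := by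
          have h2s : 17 * ε / K ^ 20 * s ≤ 17 * ε / K ^ 20 * 2 :=
            mul_le_mul_of_nonneg_left hs2 (by positivity)
          have h2e : 17 * ε / K ^ 20 * 2 = 34 * ε / K ^ 20 := by ring
          linarith
        calc ε⁻¹ * M * X s 1 ≤ ε⁻¹ * M * (ε * s + 34 * ε / K ^ 20) :=
              mul_le_mul_of_nonneg_left (by linarith) (by positivity)
          _ = k * s + β := by
              simp only [hβ, hk]; field_simp
      have hexp : exp (-(k / 2 * (s * s) + β * s)) ≤ 1 := by
        rw [exp_le_one_iff, neg_nonpos]; have := hs.1; positivity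
      have hbr : ρ ^ 2 * exp (-M) * X s 0 ^ 2 + ε⁻¹ * M * X s 1 * X s 2
          - (k * s + β) * X s 2 ≤ μ := by
        have h1 : ρ ^ 2 * exp (-M) * X s 0 ^ 2 ≤ μ := by
          simpa [hμ, hk] using mul_le_mul_of_nonneg_left ha
            (by positivity : 0 ≤ ρ ^ 2 * exp (-M))
        have h2 : ε⁻¹ * M * X s 1 * X s 2 ≤ (k * s + β) * X s 2 :=
          mul_le_mul_of_nonneg_right hνb hc0
        linarith
      calc (ρ ^ 2 * exp (-M) * X s 0 ^ 2 + ε⁻¹ * M * X s 1 * X s 2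
            - (k * s + β) * X s 2) * exp (-(k / 2 * (s * s) + β * s))
          ≤ μ * exp (-(k / 2 * (s * s) + β * s)) :=
            mul_le_mul_of_nonneg_right hbr (exp_pos _).le
        _ ≤ μ * 1 := mul_le_mul_of_nonneg_left hexp hμ0
        _ = μ := mul_one _)
  have h0mem : (0 : ℝ) ∈ Icc (0 : ℝ) τ := ⟨le_rfl, ht.1.trans ht.2⟩
  have h := hanti h0mem ht ht.1
  simp only [init_c h0, zero_mul, mul_zero, sub_zero, add_zero] at h
  have h' : X t 2 * exp (-(k / 2 * (t * t) + β * t)) ≤ μ * t := by linarith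
  have ht2 : t ≤ 2 := ht.2.trans hτ2
  have hE : X t 2 = X t 2 * exp (-(k / 2 * (t * t) + β * t)) * exp (k / 2 * (t * t) + β * t) := by
    rw [mul_assoc, ← exp_add, neg_add_cancel, exp_zero, mul_one]
  rw [hE]
  calc X t 2 * exp (-(k / 2 * (t * t) + β * t)) * exp (k / 2 * (t * t) + β * t)
      ≤ μ * t * exp (k / 2 * (t * t) + β * t) := mul_le_mul_of_nonneg_right h' (exp_pos _).le
    _ ≤ μ * 2 * exp (k / 2 * (t * t) + 1) := by
        have hβt : β * t ≤ 1 := by nlinarith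
        exact mul_le_mul (mul_le_mul_of_nonneg_left ht2 hμ0) (exp_le_exp.2 (by linarith))
          (exp_pos _).le (by positivity)
    _ = 2 * ρ ^ 2 * exp (M * t ^ 2 / 2 + 1 - M) := by
        simp only [hμ, hk]
        rw [show M * t ^ 2 / 2 + 1 - M = -M + (M / 2 * (t * t) + 1) by ring,
          exp_add (-M)]
        ring

end Summit.NavierStokesRegularity.FluidComputer.RotorKnob
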